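import Literature.NumberTheory.EllipticCurves.CanonicalPAdicHeightLocusProofs
import Literature.NumberTheory.EllipticCurves.CanonicalPAdicHeightNumeratorProofs
import Literature.NumberTheory.EllipticCurves.CanonicalPAdicHeightAdmissibleProofs
import HarnessLib

/-!
# A canonical `p`-adic height datum forces the Mazur–Tate sigma function to exist
# (the junk branch of `padicSigma` admits no canonical datum; proofs only)

Sibling proof file of `CanonicalPAdicHeight.lean` and `PadicSigma.lean` (pure proofs: no definitions,
no named facts). The tree PINS the canonical cyclotomic `p`-adic height through the sigma formula
`ĥ_p(P) = log_p(den x(P)) - 2 log_p σ_p(z(P))` (`WeierstrassCurve.canonicalPAdicHeight`,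
Stein–Wuthrich 2013 (4.1) = `-2p ×` Mazur–Stein–Tate 2006 (1.1)), where
`σ_p = padicSigma (W ⊗ ℚ_p)` is THE Mazur–Tate pair of `W ⊗ ℚ_p` chosen by `mazurTatePair` —
**with the junk value `(σ, c) = (t, 0)` when NO Mazur–Tate pair exists** (`PadicSigma.lean`,
docstring of `mazurTatePair`). The existence of the pair is a theorem for `p ≥ 5`
(`mazur_tate_sigma_existsUnique_holds`, Blakestad–Grant 2023) but at `p = 3` only the named fact
`Literature.NumberTheory.EllipticCurves.mazur_tate_sigma_exists_odd` (Mazur–Tate 1991, Thm. 3.1).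

Consumers at `p = 3` (cell bsd-rank2, crux `SchneiderOnDoorSubfamily`, stmt-19682) quantify over
`∀ Dh : PAdicHeightData W 3, Dh.IsCanonical → …` WITHOUT a sigma-existence hypothesis, and evaluate
`⟨Q, Q⟩_Dh` through the sigma formula to first order — which needs `σ_p = t + (a₁/2)t² + ⋯`
(`IsMazurTateSigmaPair.two_mul_coeff_two`), i.e. needs `σ_p` to BE a Mazur–Tate pair. This file shows
that the hypothesis `Dh.IsCanonical` already provides that, as soon as ONE admissible point `Q` with
`a₁x(Q) + a₃ ≠ 0` is at hand (automatic when `p ∤ a₁`):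

* `padicSigma_eq_X_of_not_exists`, `padicSigmaConst_eq_zero_of_not_exists`,
  `padicSigmaEval_eq_self_of_not_exists`, `canonicalPAdicHeight_some_of_not_exists` — in the junk
  branch `σ_p(t) = t` and `ĥ_p((x,y)) = log_p den x - 2 log_p(-x/y)`;
* `isAdmissible_neg` — `Q` admissible ⇒ `-Q` admissible (the locus is a subgroup:
  `exists_addSubgroup_coe_eq_localConditionsLocus_of_isIntegral`);
* `canonicalPAdicHeight_neg_sub_eq_of_not_exists` — in the junk branch
  `ĥ_p(-Q) - ĥ_p(Q) = 2 log_p(1 + (a₁x + a₃)/y)` for `Q = (x, y) ∈ E₁(ℚ_p)`, and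
  `canonicalPAdicHeight_neg_ne_of_not_exists` — this is `≠ 0` when `a₁x + a₃ ≠ 0` (`p` odd:
  `‖(a₁x + a₃)/y‖ ≤ ‖x/y‖ < 1` and `log_p` is an isometry on `1 + pℤ_p`), whereas every datum has
  `⟨-Q, -Q⟩ = ⟨Q, Q⟩`;
* **`PAdicHeightData.IsCanonical.exists_isMazurTateSigmaPair`** — for a `ℤ`-integral elliptic `W/ℚ`,
  `p` odd, a canonical `Dh` and an admissible `Q = (x, y)` with `a₁x + a₃ ≠ 0`:
  `∃ σ c, (W ⊗ ℚ_p).IsMazurTateSigmaPair σ c`; hence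
  **`PAdicHeightData.IsCanonical.isMazurTateSigmaPair_padicSigma`** (`σ_p` IS a Mazur–Tate pair) and
  the variants `…_of_norm_a₁_eq_one` (`‖a₁‖_p = 1`, when `a₁x(Q) + a₃ ≠ 0` is automatic:
  `a₁_mul_add_a₃_ne_zero_of_norm_a₁_eq_one`).

* §2 (supplying the point): `isAdmissible_nsmul`, `eq_or_eq_neg_of_xCoord_eq`,
  `exists_isAdmissible_a₁_mul_add_a₃_ne_zero` (infinite-order point + `(a₁,a₃) ≠ (0,0)` ⇒ an
  admissible `Q` with `a₁x(Q) + a₃ ≠ 0`), `exists_Δ_eq_sixteen_mul_of_a₁_a₃` /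
  `a₁_ne_zero_or_a₃_ne_zero_of_not_sixteen_dvd` (`16 ∤ Δ ⇒ (a₁,a₃) ≠ (0,0)`),
  `exists_not_isOfFinAddOrder_of_mordellWeilRank_ne_zero`, and the packaged
  **`IsCanonical.isMazurTateSigmaPair_padicSigma_of_mordellWeilRank_ne_zero`** (rank `≠ 0`,
  `(a₁,a₃) ≠ (0,0)`, `p` odd ⇒ `σ_p` is a Mazur–Tate pair).

So a proof about canonical data at `p = 3` needs no case split on the junk branch and no appeal to
`mazur_tate_sigma_exists_odd`: from `Dh.IsCanonical` and one admissible point it GETS the pair.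
(Mathematically the junk branch never occurs — Mazur–Tate 1991, Thm. 3.1 — and nothing here asserts
that it does; these are bookkeeping lemmas about the tree's own conventions.)

## References

* [MazurSteinTate2006] B. Mazur, W. Stein, J. Tate, *Computation of `p`-adic heights and log
  convergence*, Doc. Math. Extra Vol. Coates (2006), §1 eq. (1.1), Thm. 1.3 (`σ = t + ⋯ ∈ tℤ_p⟦t⟧`).
* [SteinWuthrich2013] W. Stein, C. Wuthrich, Math. Comp. 82 (2013), §4.1 eq. (4.1).
* [MazurTate1991] B. Mazur, J. Tate, *The `p`-adic sigma function*, Duke Math. J. 62 (1991), Thm. 3.1.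
* [Iwasawa1972PadicL] K. Iwasawa, *Lectures on `p`-adic `L`-functions* (1972), §4.4 (`log_p`).
* [SilvermanAEC2009] J. H. Silverman, *AEC* 2nd ed., VII.2.1–2.2 (`E₀`, `E₁`, `3v(x) = 2v(y)`).

## Design

Pure proof file: no `def`, no named fact, standard axioms. Hypotheses are `[W.IsIntegral ℤ]`
(+ `[W.IsElliptic]` where the locus subgroup is used) and `p ≠ 2`; no minimality, no reduction type.
-/

noncomputable section

open scoped Classical
open PowerSeries Literature.NumberTheory.EllipticCurves

namespace WeierstrassCurve

/-! ### The junk branch of `mazurTatePair` -/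

section Junk

variable {p : ℕ} [Fact p.Prime] (V : WeierstrassCurve ℚ_[p])

/-- If `V/ℚ_p` has no Mazur–Tate pair, the chosen pair is the junk `(t, 0)` (definition of
`mazurTatePair`; the junk branch is the tree's convention, the pair is Mazur–Stein–Tate's).
[cite: MazurSteinTate2006, Thm. 1.3] -/
theorem mazurTatePair_eq_of_not_exists
    (h : ¬ ∃ σ : ℚ_[p]⟦X⟧, ∃ c : ℚ_[p], V.IsMazurTateSigmaPair σ c) :
    V.mazurTatePair = (X, 0) := by
  unfold mazurTatePair
  rw [dif_neg]
  rintro ⟨σc, hσc⟩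
  exact h ⟨σc.1, σc.2, hσc⟩

/-- Junk branch: `σ_p = t` (no Mazur–Tate pair ⇒ the chosen series is the junk `X`).
[cite: MazurSteinTate2006, Thm. 1.3] -/
theorem padicSigma_eq_X_of_not_exists
    (h : ¬ ∃ σ : ℚ_[p]⟦X⟧, ∃ c : ℚ_[p], V.IsMazurTateSigmaPair σ c) : V.padicSigma = X := by
  rw [padicSigma, V.mazurTatePair_eq_of_not_exists h]

/-- Junk branch: `c = 0`. [cite: MazurSteinTate2006, Thm. 1.3] -/
theorem padicSigmaConst_eq_zero_of_not_exists
    (h : ¬ ∃ σ : ℚ_[p]⟦X⟧, ∃ c : ℚ_[p], V.IsMazurTateSigmaPair σ c) : V.padicSigmaConst = 0 := by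
  rw [padicSigmaConst, V.mazurTatePair_eq_of_not_exists h]

/-- Conversely, whenever a pair exists the chosen `(σ_p, c)` is one (restated for symmetry with the
junk branch; this is `isMazurTateSigmaPair_padicSigma`). [cite: MazurSteinTate2006, Thm. 1.3] -/
theorem isMazurTateSigmaPair_padicSigma_of_exists
    (h : ∃ σ : ℚ_[p]⟦X⟧, ∃ c : ℚ_[p], V.IsMazurTateSigmaPair σ c) :
    V.IsMazurTateSigmaPair V.padicSigma V.padicSigmaConst :=
  V.isMazurTateSigmaPair_padicSigma h

end Junk

/-! ### The sigma formula in the junk branch -/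

section Rat

variable (W : WeierstrassCurve ℚ) (p : ℕ) [Fact p.Prime]

/-- Junk branch: `σ_p(t) = t` for every `t ∈ ℚ_p` (the evaluation `padicSigmaEval` of the junk series `X`).
[cite: MazurSteinTate2006, Thm. 1.3] -/
theorem padicSigmaEval_eq_self_of_not_exists
    (h : ¬ ∃ σ : ℚ_[p]⟦X⟧, ∃ c : ℚ_[p], (W.baseChange ℚ_[p]).IsMazurTateSigmaPair σ c) (t : ℚ_[p]) :
    W.padicSigmaEval p t = t := by
  unfold padicSigmaEval
  rw [(W.baseChange ℚ_[p]).padicSigma_eq_X_of_not_exists h]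
  rw [tsum_eq_single 1 (fun n hn => by rw [coeff_X, if_neg hn, zero_mul])]
  simp [coeff_X]

variable {W p} in
/-- Junk branch: the sigma formula collapses to `ĥ_p((x, y)) = log_p(den x) - 2 log_p(-x/y)`.
[Stein–Wuthrich 2013, §4.1 eq. (4.1) (the formula); tree convention for the junk branch]
[cite: SteinWuthrich2013, §4.1 eq. (4.1)] -/
theorem canonicalPAdicHeight_some_of_not_exists
    (h : ¬ ∃ σ : ℚ_[p]⟦X⟧, ∃ c : ℚ_[p], (W.baseChange ℚ_[p]).IsMazurTateSigmaPair σ c)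
    {x y : ℚ} (hxy : W.toAffine.Nonsingular x y) :
    W.canonicalPAdicHeight p (.some x y hxy) =
      padicLog p ((x.den : ℚ) : ℚ_[p]) - 2 * padicLog p (-(x : ℚ_[p]) / y) := by
  rw [canonicalPAdicHeight_some, padicSigmaAt, padicParam_some, W.padicSigmaEval_eq_self_of_not_exists p h]

/-! ### Negation preserves admissibility -/

variable {W p} in
/-- **`Q` admissible ⇒ `-Q` admissible** (any `ℤ`-integral elliptic equation, any prime): the
admissible locus together with `O` is a subgroup of `E(ℚ)` (`E(ℚ) ∩ E₁(ℚ_p) ∩ ⋂_ℓ E₀(ℚ_ℓ)`,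
`exists_addSubgroup_coe_eq_localConditionsLocus_of_isIntegral`), and `-Q` is torsion iff `Q` is.
[Silverman AEC VII.2.1, VII.2.2; Mazur–Stein–Tate 2006, §2.6] [cite: SilvermanAEC2009, VII.2.1] -/
theorem isAdmissible_neg [W.IsElliptic] [W.IsIntegral ℤ] {Q : W.toAffine.Point}
    (hQ : W.IsAdmissible p Q) : W.IsAdmissible p (-Q) := by
  refine ⟨fun hfin => hQ.1 (by simpa using hfin.neg), ?_⟩
  obtain ⟨H, hH⟩ := W.exists_addSubgroup_coe_eq_localConditionsLocus_of_isIntegral p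
  have hQH : Q ∈ H := by
    rw [← SetLike.mem_coe, hH]
    exact hQ.mem_localConditionsLocus
  have hnegH : -Q ∈ W.localConditionsLocus p := by
    rw [← hH, SetLike.mem_coe]
    exact H.neg_mem hQH
  exact mem_localConditionsLocus_of_ne_zero hnegH
    (neg_ne_zero.mpr (ne_zero_of_satisfiesLocalConditions hQ.2))

/-! ### In the junk branch `ĥ_p(-Q) ≠ ĥ_p(Q)` -/

variable {W p} in
/-- Norm bookkeeping on `E₁(ℚ_p)` for a `ℤ`-integral equation: if `‖x‖_p > 1` then `y ≠ 0`,
`y + a₁x + a₃ ≠ 0`, and `w = (a₁x + a₃)/y` has `‖w‖_p ≤ ‖x/y‖_p < 1`.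
[Silverman AEC VII.2.2 (`3v(x) = 2v(y)` on `E₁`)] [cite: SilvermanAEC2009, VII.2.2] -/
theorem norm_a₁x_add_a₃_div_y_lt_one [W.IsIntegral ℤ] {x y : ℚ} (hxy : W.toAffine.Nonsingular x y)
    (hx : 1 < ‖(x : ℚ_[p])‖) :
    (y : ℚ_[p]) ≠ 0 ∧ ‖((W.a₁ * x + W.a₃ : ℚ) : ℚ_[p]) / y‖ ≤ ‖(x : ℚ_[p]) / y‖ ∧
      ‖(x : ℚ_[p]) / y‖ < 1 ∧ ((y + (W.a₁ * x + W.a₃) : ℚ) : ℚ_[p]) ≠ 0 := by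
  have hsq := norm_div_sq_eq_inv_norm_of_one_lt_norm (p := p) hxy hx
  have hx0 : (x : ℚ_[p]) ≠ 0 := by
    intro h0; rw [h0, norm_zero] at hx; exact (not_lt.mpr zero_le_one) hx
  have hxpos : 0 < ‖(x : ℚ_[p])‖ := norm_pos_iff.mpr hx0
  -- `‖x/y‖ < 1`
  have hz1 : ‖(x : ℚ_[p]) / y‖ < 1 := by
    have h1 : ‖(x : ℚ_[p]) / y‖ ^ 2 < 1 := by rw [hsq]; exact inv_lt_one_of_one_lt₀ hx
    by_contra hge
    rw [not_lt] at hge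
    have : (1 : ℝ) ≤ ‖(x : ℚ_[p]) / y‖ ^ 2 := by nlinarith [norm_nonneg ((x : ℚ_[p]) / y)]
    linarith
  -- `y ≠ 0` (else `‖x/y‖ = 0` and `0 = ‖x‖⁻¹ > 0`)
  have hy0 : (y : ℚ_[p]) ≠ 0 := by
    intro h0
    rw [h0, div_zero, norm_zero, zero_pow two_ne_zero] at hsq
    exact (inv_pos.mpr hxpos).ne hsq
  have hypos : 0 < ‖(y : ℚ_[p])‖ := norm_pos_iff.mpr hy0
  -- `‖a₁x + a₃‖ ≤ ‖x‖`
  have ha₁ : ‖((W.a₁ : ℚ) : ℚ_[p])‖ ≤ 1 := (mem_localIntegers_iff p _).mp (W.a₁_mem_localIntegers p)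
  have ha₃ : ‖((W.a₃ : ℚ) : ℚ_[p])‖ ≤ 1 := (mem_localIntegers_iff p _).mp (W.a₃_mem_localIntegers p)
  have hnum : ‖((W.a₁ * x + W.a₃ : ℚ) : ℚ_[p])‖ ≤ ‖(x : ℚ_[p])‖ := by
    push_cast
    refine (IsUltrametricDist.norm_add_le_max _ _).trans (max_le ?_ ?_)
    · rw [norm_mul]
      calc ‖((W.a₁ : ℚ) : ℚ_[p])‖ * ‖(x : ℚ_[p])‖ ≤ 1 * ‖(x : ℚ_[p])‖ := by gcongr
        _ = ‖(x : ℚ_[p])‖ := one_mul _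
    · exact ha₃.trans hx.le
  have hw : ‖((W.a₁ * x + W.a₃ : ℚ) : ℚ_[p]) / y‖ ≤ ‖(x : ℚ_[p]) / y‖ := by
    rw [norm_div, norm_div]
    exact div_le_div_of_nonneg_right hnum hypos.le
  refine ⟨hy0, hw, hz1, ?_⟩
  -- `y + a₁x + a₃ ≠ 0`: else `‖(a₁x + a₃)/y‖ = 1`
  intro h0
  have hw1 : ‖((W.a₁ * x + W.a₃ : ℚ) : ℚ_[p]) / y‖ = 1 := by
    have : (((W.a₁ * x + W.a₃ : ℚ) : ℚ_[p])) = -(y : ℚ_[p]) := by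
      push_cast at h0 ⊢; linear_combination h0
    rw [this, neg_div, norm_neg, div_self hy0, norm_one]
  linarith [hw.trans_lt hz1]

variable {W p} in
/-- **In the junk branch `ĥ_p(-Q) - ĥ_p(Q) = 2 log_p(1 + (a₁x + a₃)/y)`** for `Q = (x, y)` with
`‖x‖_p > 1` on a `ℤ`-integral equation (`-Q = (x, -y - a₁x - a₃)`, same denominator of `x`,
`log_p(-u) = log_p u`, `log_p(uv) = log_p u + log_p v`). [Iwasawa 1972, §4.4; Silverman AEC III.2.3
(negation formula)] [cite: SteinWuthrich2013, §4.1 eq. (4.1)] [cite: Iwasawa1972PadicL, §4.4] -/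
theorem canonicalPAdicHeight_neg_sub_eq_of_not_exists [W.IsIntegral ℤ]
    (h : ¬ ∃ σ : ℚ_[p]⟦X⟧, ∃ c : ℚ_[p], (W.baseChange ℚ_[p]).IsMazurTateSigmaPair σ c)
    {x y : ℚ} (hxy : W.toAffine.Nonsingular x y) (hx : 1 < ‖(x : ℚ_[p])‖) :
    W.canonicalPAdicHeight p (-(.some x y hxy)) - W.canonicalPAdicHeight p (.some x y hxy) =
      2 * padicLog p (1 + ((W.a₁ * x + W.a₃ : ℚ) : ℚ_[p]) / y) := by
  obtain ⟨hy0, -, -, hN0⟩ := W.norm_a₁x_add_a₃_div_y_lt_one (p := p) hxy hx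
  have hx0 : (x : ℚ_[p]) ≠ 0 := by
    intro h0; rw [h0, norm_zero] at hx; exact (not_lt.mpr zero_le_one) hx
  rw [Affine.Point.neg_some, canonicalPAdicHeight_some_of_not_exists h,
    canonicalPAdicHeight_some_of_not_exists h]
  -- the new `y`-coordinate, cast to `ℚ_p`
  have hnegY : ((W.toAffine.negY x y : ℚ) : ℚ_[p]) = -((y + (W.a₁ * x + W.a₃) : ℚ) : ℚ_[p]) := by
    rw [Affine.negY]; push_cast; ring
  set N : ℚ_[p] := ((y + (W.a₁ * x + W.a₃) : ℚ) : ℚ_[p]) with hNdef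
  have hq1 : -(x : ℚ_[p]) / ((W.toAffine.negY x y : ℚ) : ℚ_[p]) = (x : ℚ_[p]) / N := by
    rw [hnegY, neg_div_neg_eq]
  rw [hq1]
  -- `log(-x/y) = log(x/N) + log(N/y)` and `N/y = 1 + w`
  have hxN : (x : ℚ_[p]) / N ≠ 0 := div_ne_zero hx0 hN0
  have hNy : N / (y : ℚ_[p]) ≠ 0 := div_ne_zero hN0 hy0
  have hsplit : padicLog p (-(x : ℚ_[p]) / y) = padicLog p ((x : ℚ_[p]) / N) + padicLog p (N / y) := by
    rw [neg_div, padicLog_neg (div_ne_zero hx0 hy0), ← padicLog_mul_holds p hxN hNy]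
    congr 1
    field_simp
  have hw : N / (y : ℚ_[p]) = 1 + ((W.a₁ * x + W.a₃ : ℚ) : ℚ_[p]) / y := by
    rw [hNdef]; push_cast; field_simp
  rw [hsplit, hw]
  ring

variable {W p} in
/-- **In the junk branch `ĥ_p(-Q) ≠ ĥ_p(Q)`** for `p` odd, `Q = (x, y)` with `‖x‖_p > 1` on a
`ℤ`-integral equation and `a₁x + a₃ ≠ 0`: `w = (a₁x + a₃)/y` has `0 < ‖w‖_p < 1`, so
`log_p(1 + w) ≠ 0` by the isometry of `log_p` on `1 + pℤ_p` (`‖2‖_p = 1`).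
[cite: Iwasawa1972PadicL, §4.4] [cite: SteinWuthrich2013, §4.1 eq. (4.1)] -/
theorem canonicalPAdicHeight_neg_ne_of_not_exists [W.IsIntegral ℤ] (hp : p ≠ 2)
    (h : ¬ ∃ σ : ℚ_[p]⟦X⟧, ∃ c : ℚ_[p], (W.baseChange ℚ_[p]).IsMazurTateSigmaPair σ c)
    {x y : ℚ} (hxy : W.toAffine.Nonsingular x y) (hx : 1 < ‖(x : ℚ_[p])‖)
    (ha : W.a₁ * x + W.a₃ ≠ 0) :
    W.canonicalPAdicHeight p (-(.some x y hxy)) ≠ W.canonicalPAdicHeight p (.some x y hxy) := by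
  intro heq
  obtain ⟨hy0, hwle, hz1, -⟩ := W.norm_a₁x_add_a₃_div_y_lt_one (p := p) hxy hx
  have hsub := W.canonicalPAdicHeight_neg_sub_eq_of_not_exists (p := p) h hxy hx
  rw [heq, sub_self] at hsub
  have hlog : padicLog p (1 + ((W.a₁ * x + W.a₃ : ℚ) : ℚ_[p]) / y) = 0 := by
    have h2 : (2 : ℚ_[p]) ≠ 0 := two_ne_zero
    exact (mul_eq_zero.mp hsub.symm).resolve_left h2
  set w : ℚ_[p] := ((W.a₁ * x + W.a₃ : ℚ) : ℚ_[p]) / y with hwdef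
  have hw1 : ‖w‖ < 1 := hwle.trans_lt hz1
  have hw1' : ‖1 - (1 + w)‖ < 1 := by rwa [sub_add_cancel_left, norm_neg]
  have h2norm : ‖(2 : ℚ_[p])‖ = 1 := by
    rw [show (2 : ℚ_[p]) = ((2 : ℕ) : ℚ_[p]) by norm_cast, Padic.norm_natCast_eq_one_iff]
    exact (Nat.coprime_primes (Fact.out) Nat.prime_two).mpr hp
  have hw2 : ‖1 - (1 + w)‖ < ‖(2 : ℚ_[p])‖ := by rwa [h2norm]
  rw [padicLog_eq_padicLogSeries hw1'] at hlog
  have hnorm := norm_padicLogSeries_eq hw2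
  rw [hlog, norm_zero, sub_add_cancel_left, norm_neg] at hnorm
  have hw0 : w = 0 := norm_eq_zero.mp hnorm.symm
  rw [hwdef, div_eq_zero_iff] at hw0
  rcases hw0 with hw0 | hw0
  · exact ha (by exact_mod_cast hw0)
  · exact hy0 hw0

/-! ### A canonical datum forces the pair to exist -/

variable {W p} in
/-- **A canonical `p`-adic height datum exists only in the genuine branch.** For a `ℤ`-integral
elliptic `W/ℚ`, an odd prime `p`, a datum `Dh : PAdicHeightData W p` with `Dh.IsCanonical`, and ONE
admissible point `Q = (x, y)` with `a₁x + a₃ ≠ 0`, the Weierstrass curve `W ⊗ ℚ_p` HAS a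
Mazur–Tate pair: otherwise `σ_p` is the junk `t`, `-Q` is admissible as well, and
`⟨Q, Q⟩ = ĥ_p(Q) ≠ ĥ_p(-Q) = ⟨-Q, -Q⟩ = ⟨Q, Q⟩`. [cite: MazurSteinTate2006, Thm. 1.3 and §1 eq. (1.1)]
[cite: SteinWuthrich2013, §4.1 eq. (4.1)] -/
theorem PAdicHeightData.IsCanonical.exists_isMazurTateSigmaPair [W.IsElliptic] [W.IsIntegral ℤ]
    (hp : p ≠ 2) {Dh : PAdicHeightData W p} (hDh : Dh.IsCanonical) {x y : ℚ}
    {hxy : W.toAffine.Nonsingular x y} (hQ : W.IsAdmissible p (.some x y hxy))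
    (ha : W.a₁ * x + W.a₃ ≠ 0) :
    ∃ σ : ℚ_[p]⟦X⟧, ∃ c : ℚ_[p], (W.baseChange ℚ_[p]).IsMazurTateSigmaPair σ c := by
  by_contra h
  have hx : 1 < ‖(x : ℚ_[p])‖ := hQ.2.1
  have h1 := hDh _ hQ
  have h2 := hDh _ (isAdmissible_neg hQ)
  have h3 : Dh.pairing (-(.some x y hxy : W.toAffine.Point)) (-(.some x y hxy)) =
      Dh.pairing (.some x y hxy) (.some x y hxy) := by
    simp only [map_neg, AddMonoidHom.neg_apply, neg_neg]
  exact W.canonicalPAdicHeight_neg_ne_of_not_exists hp h hxy hx ha (by rw [← h2, h3, h1])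

variable {W p} in
/-- **With a canonical datum at hand, `σ_p` IS a Mazur–Tate pair**: `σ_p(0) = 0`, `σ_p'(0) = 1`,
`2[t²]σ_p = a₁`, all coefficients in `ℤ_p`, odd, sigma ODE — everything the first-order evaluation
of `⟨Q, Q⟩_Dh` uses (same hypotheses as `exists_isMazurTateSigmaPair`).
[cite: MazurSteinTate2006, Thm. 1.3] -/
theorem PAdicHeightData.IsCanonical.isMazurTateSigmaPair_padicSigma [W.IsElliptic] [W.IsIntegral ℤ]
    (hp : p ≠ 2) {Dh : PAdicHeightData W p} (hDh : Dh.IsCanonical) {x y : ℚ}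
    {hxy : W.toAffine.Nonsingular x y} (hQ : W.IsAdmissible p (.some x y hxy))
    (ha : W.a₁ * x + W.a₃ ≠ 0) :
    (W.baseChange ℚ_[p]).IsMazurTateSigmaPair (W.baseChange ℚ_[p]).padicSigma
      (W.baseChange ℚ_[p]).padicSigmaConst :=
  (W.baseChange ℚ_[p]).isMazurTateSigmaPair_padicSigma (hDh.exists_isMazurTateSigmaPair hp hQ ha)

/-! ### When `a₁x(Q) + a₃ ≠ 0` is automatic -/

variable {W p} in
/-- If `‖a₁‖_p = 1` (an integral `a₁` prime to `p`) then `a₁x + a₃ ≠ 0` for every point `(x, y)`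
with `‖x‖_p > 1` (`‖a₁x‖_p = ‖x‖_p > 1 ≥ ‖a₃‖_p`). [cite: SilvermanAEC2009, VII.2.2] -/
theorem a₁_mul_add_a₃_ne_zero_of_norm_a₁_eq_one [W.IsIntegral ℤ] {x : ℚ}
    (hx : 1 < ‖(x : ℚ_[p])‖) (ha₁ : ‖((W.a₁ : ℚ) : ℚ_[p])‖ = 1) : W.a₁ * x + W.a₃ ≠ 0 := by
  intro h0
  have ha₃ : ‖((W.a₃ : ℚ) : ℚ_[p])‖ ≤ 1 := (mem_localIntegers_iff p _).mp (W.a₃_mem_localIntegers p)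
  have h1 : ((W.a₃ : ℚ) : ℚ_[p]) = -(((W.a₁ : ℚ) : ℚ_[p]) * (x : ℚ_[p])) := by
    have := congrArg (fun q : ℚ => (q : ℚ_[p])) h0
    push_cast at this
    linear_combination this
  have h2 : ‖((W.a₃ : ℚ) : ℚ_[p])‖ = ‖(x : ℚ_[p])‖ := by rw [h1, norm_neg, norm_mul, ha₁, one_mul]
  linarith

variable {W p} in
/-- An admissible point with `‖a₁‖_p = 1` satisfies `a₁x(Q) + a₃ ≠ 0` (admissible points lie in
`E₁(ℚ_p)`: `‖x‖_p > 1`). [cite: MazurSteinTate2006, §1] [cite: SilvermanAEC2009, VII.2.2] -/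
theorem a₁_mul_add_a₃_ne_zero_of_isAdmissible [W.IsIntegral ℤ] {x y : ℚ}
    {hxy : W.toAffine.Nonsingular x y} (hQ : W.IsAdmissible p (.some x y hxy))
    (ha₁ : ‖((W.a₁ : ℚ) : ℚ_[p])‖ = 1) : W.a₁ * x + W.a₃ ≠ 0 :=
  W.a₁_mul_add_a₃_ne_zero_of_norm_a₁_eq_one (p := p) hQ.2.1 ha₁

variable {W p} in
/-- **Canonical datum + one admissible point + `p ∤ a₁` ⇒ the Mazur–Tate pair exists.**
[cite: MazurSteinTate2006, Thm. 1.3] -/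
theorem PAdicHeightData.IsCanonical.exists_isMazurTateSigmaPair_of_norm_a₁_eq_one [W.IsElliptic]
    [W.IsIntegral ℤ] (hp : p ≠ 2) {Dh : PAdicHeightData W p} (hDh : Dh.IsCanonical) {x y : ℚ}
    {hxy : W.toAffine.Nonsingular x y} (hQ : W.IsAdmissible p (.some x y hxy))
    (ha₁ : ‖((W.a₁ : ℚ) : ℚ_[p])‖ = 1) :
    ∃ σ : ℚ_[p]⟦X⟧, ∃ c : ℚ_[p], (W.baseChange ℚ_[p]).IsMazurTateSigmaPair σ c :=
  hDh.exists_isMazurTateSigmaPair hp hQ (a₁_mul_add_a₃_ne_zero_of_isAdmissible hQ ha₁)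

variable {W p} in
/-- **Canonical datum + one admissible point + `p ∤ a₁` ⇒ `σ_p` is a Mazur–Tate pair.** On the
door class of the cell's counting route at `p = 3` (`3 ∤ a₁`, which for its `a₂ = 0` models is the
ordinarity at `3`) this is the form used: no case split on the junk branch remains.
[cite: MazurSteinTate2006, Thm. 1.3] -/
theorem PAdicHeightData.IsCanonical.isMazurTateSigmaPair_padicSigma_of_norm_a₁_eq_one [W.IsElliptic]
    [W.IsIntegral ℤ] (hp : p ≠ 2) {Dh : PAdicHeightData W p} (hDh : Dh.IsCanonical) {x y : ℚ}
    {hxy : W.toAffine.Nonsingular x y} (hQ : W.IsAdmissible p (.some x y hxy))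
    (ha₁ : ‖((W.a₁ : ℚ) : ℚ_[p])‖ = 1) :
    (W.baseChange ℚ_[p]).IsMazurTateSigmaPair (W.baseChange ℚ_[p]).padicSigma
      (W.baseChange ℚ_[p]).padicSigmaConst :=
  hDh.isMazurTateSigmaPair_padicSigma hp hQ (a₁_mul_add_a₃_ne_zero_of_isAdmissible hQ ha₁)

variable {W p} in
/-- Point-free packaging: a canonical datum and ANY admissible point `Q` (affine by definition) with
`a₁x(Q) + a₃ ≠ 0` give the pair. [cite: MazurSteinTate2006, Thm. 1.3] -/
theorem PAdicHeightData.IsCanonical.exists_isMazurTateSigmaPair_of_point [W.IsElliptic] [W.IsIntegral ℤ]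
    (hp : p ≠ 2) {Dh : PAdicHeightData W p} (hDh : Dh.IsCanonical) {Q : W.toAffine.Point}
    (hQ : W.IsAdmissible p Q) (ha : W.a₁ * W.xCoord Q + W.a₃ ≠ 0) :
    ∃ σ : ℚ_[p]⟦X⟧, ∃ c : ℚ_[p], (W.baseChange ℚ_[p]).IsMazurTateSigmaPair σ c := by
  rcases Q with _ | ⟨x, y, hxy⟩
  · exact absurd hQ (W.not_isAdmissible_zero p)
  · rw [xCoord_some] at ha
    exact hDh.exists_isMazurTateSigmaPair hp hQ ha

/-! ### §2. Supplying the admissible point: multiples, positive rank, and `(a₁, a₃) ≠ (0, 0)`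

The hypotheses of `PAdicHeightData.IsCanonical.exists_isMazurTateSigmaPair` are an admissible point
`Q` with `a₁x(Q) + a₃ ≠ 0`. This section produces such a point from the data a consumer actually has:
a point of infinite order (or `rank E(ℚ) ≥ 1`) and `(a₁, a₃) ≠ (0, 0)` — the latter being automatic
for every `ℤ`-integral equation with `16 ∤ Δ` (an equation `y² = x³ + a₂x² + a₄x + a₆` has
`Δ = 16·disc`), in particular on every square-free-sieved family and on every model
`(±1, r, s, t) • W` of a member (same `Δ`). -/

variable {W p} in
/-- **Non-zero multiples of an admissible point are admissible** (any `ℤ`-integral elliptic equation,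
any prime): the locus is a subgroup and `E₁(ℚ_p)`-membership plus non-singular reduction are inherited,
while `n • Q` is torsion only if `Q` is. [Silverman AEC VII.2.1, VII.2.2; Mazur–Stein–Tate 2006, §1
("replace `P` by a multiple")] [cite: SilvermanAEC2009, VII.2.1] [cite: MazurSteinTate2006, §1] -/
theorem isAdmissible_nsmul [W.IsElliptic] [W.IsIntegral ℤ] {Q : W.toAffine.Point}
    (hQ : W.IsAdmissible p Q) {n : ℕ} (hn : n ≠ 0) : W.IsAdmissible p (n • Q) := by
  have hnt : ¬ IsOfFinAddOrder (n • Q) := by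
    intro hfin
    obtain ⟨k, hk, hk0⟩ := (isOfFinAddOrder_iff_nsmul_eq_zero).1 hfin
    refine hQ.1 ((isOfFinAddOrder_iff_nsmul_eq_zero).2 ⟨k * n, Nat.mul_pos hk (Nat.pos_of_ne_zero hn), ?_⟩)
    rwa [mul_nsmul']
  refine ⟨hnt, ?_⟩
  obtain ⟨H, hH⟩ := W.exists_addSubgroup_coe_eq_localConditionsLocus_of_isIntegral p
  have hQH : Q ∈ H := by
    rw [← SetLike.mem_coe, hH]
    exact hQ.mem_localConditionsLocus
  have hnH : n • Q ∈ W.localConditionsLocus p := by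
    rw [← hH, SetLike.mem_coe]
    exact H.nsmul_mem hQH n
  refine mem_localConditionsLocus_of_ne_zero hnH fun h0 => hnt ?_
  rw [h0]
  exact IsOfFinAddOrder.zero

variable {W p} in
/-- Two non-zero points with the same `x`-coordinate are equal or opposite (`y² + a₁xy + a₃y` takes
each value at most twice in `y`; Mathlib `Affine.Point.X_eq_iff`). [Silverman AEC III.2.3]
[cite: SilvermanAEC2009, III.2.3] -/
theorem eq_or_eq_neg_of_xCoord_eq {P₁ P₂ : W.toAffine.Point} (h₁ : P₁ ≠ 0) (h₂ : P₂ ≠ 0)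
    (hx : W.xCoord P₁ = W.xCoord P₂) : P₁ = P₂ ∨ P₁ = -P₂ := by
  rcases P₁ with _ | ⟨x₁, y₁, hxy₁⟩
  · exact absurd rfl h₁
  rcases P₂ with _ | ⟨x₂, y₂, hxy₂⟩
  · exact absurd rfl h₂
  rw [xCoord_some, xCoord_some] at hx
  exact Affine.Point.X_eq_iff.mp hx

variable {W p} in
/-- **An admissible point with `a₁x + a₃ ≠ 0` exists** as soon as `E(ℚ)` has a point of infinite
order and `(a₁, a₃) ≠ (0, 0)` (any `ℤ`-integral elliptic equation, any prime `p`): take an admissible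
multiple `Q = m • P` (`exists_admissible_nsmul_of_isIntegral`); if `a₁ = 0` then `a₁x + a₃ = a₃ ≠ 0`;
if `a₁ ≠ 0`, at most the two points `±R₀` have `x = -a₃/a₁`, and `Q`, `2 • Q` are admissible, distinct
and not opposite (`Q` is not `3`-torsion). [Mazur–Stein–Tate 2006, §1; Silverman AEC VII.6.2]
[cite: MazurSteinTate2006, §1] [cite: SilvermanAEC2009, VII.6 Cor. 6.2] -/
theorem exists_isAdmissible_a₁_mul_add_a₃_ne_zero [W.IsElliptic] [W.IsIntegral ℤ]
    {P : W.toAffine.Point} (hP : ¬ IsOfFinAddOrder P) (ha : W.a₁ ≠ 0 ∨ W.a₃ ≠ 0) :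
    ∃ (x y : ℚ) (hxy : W.toAffine.Nonsingular x y),
      W.IsAdmissible p (.some x y hxy) ∧ W.a₁ * x + W.a₃ ≠ 0 := by
  obtain ⟨m, hm, hQ⟩ := W.exists_admissible_nsmul_of_isIntegral p P hP
  set Q : W.toAffine.Point := m • P with hQdef
  -- a non-zero admissible point, in coordinates, either works or has `x = -a₃/a₁`
  have key : ∀ {R : W.toAffine.Point}, W.IsAdmissible p R →
      (∃ (x y : ℚ) (hxy : W.toAffine.Nonsingular x y),
        W.IsAdmissible p (.some x y hxy) ∧ W.a₁ * x + W.a₃ ≠ 0) ∨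
      (W.a₁ ≠ 0 ∧ W.a₁ * W.xCoord R + W.a₃ = 0) := by
    intro R hR
    have hR0 : R ≠ 0 := fun h0 => hR.1 (h0 ▸ IsOfFinAddOrder.zero)
    rcases R with _ | ⟨x, y, hxy⟩
    · exact absurd rfl hR0
    by_cases hax : W.a₁ * x + W.a₃ = 0
    · refine Or.inr ⟨?_, by rwa [xCoord_some]⟩
      rcases ha with ha₁ | ha₃
      · exact ha₁
      · intro ha₁; rw [ha₁, zero_mul, zero_add] at hax; exact ha₃ hax
    · exact Or.inl ⟨x, y, hxy, hR, hax⟩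
  rcases key hQ with h | ⟨ha₁, hxQ⟩
  · exact h
  rcases key (isAdmissible_nsmul hQ two_ne_zero) with h | ⟨-, hx2Q⟩
  · exact h
  -- both `Q` and `2Q` have `x = -a₃/a₁`: then `2Q = ±Q`, contradicting non-torsion
  exfalso
  have hQ0 : Q ≠ 0 := fun h0 => hQ.1 (h0 ▸ IsOfFinAddOrder.zero)
  have h2Q0 : (2 • Q) ≠ 0 := fun h0 => (isAdmissible_nsmul hQ two_ne_zero).1 (h0 ▸ IsOfFinAddOrder.zero)
  have hx : W.xCoord Q = W.xCoord (2 • Q) := by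
    have e1 : W.xCoord Q = -W.a₃ / W.a₁ := by field_simp; linear_combination hxQ
    have e2 : W.xCoord (2 • Q) = -W.a₃ / W.a₁ := by field_simp; linear_combination hx2Q
    rw [e1, e2]
  rcases eq_or_eq_neg_of_xCoord_eq hQ0 h2Q0 hx with heq | heq
  · -- `Q = 2Q` forces `Q = 0`
    have : Q + Q = Q + 0 := by rw [add_zero, ← two_nsmul]; exact heq.symm
    exact hQ0 (add_left_cancel this)
  · -- `Q = -2Q` forces `3Q = 0`
    have h3 : (3 : ℕ) • Q = 0 := by
      rw [show (3 : ℕ) = 1 + 2 from rfl, add_nsmul, one_nsmul]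
      nth_rw 1 [heq]
      exact neg_add_cancel _
    exact hQ.1 ((isOfFinAddOrder_iff_nsmul_eq_zero).2 ⟨3, by norm_num, h3⟩)

/-- **`a₁ = a₃ = 0 ⇒ 16 ∣ Δ`** over any ring: for `y² = x³ + a₂x² + a₄x + a₆` one has
`Δ = 16·(a₂²a₄² - 4a₂³a₆ + 18a₂a₄a₆ - 4a₄³ - 27a₆²) = 16·disc(cubic)`.
[Silverman AEC III.1 (formulas for `b₂, …, Δ`)] [cite: SilvermanAEC2009, III.1] -/
theorem exists_Δ_eq_sixteen_mul_of_a₁_a₃ {R : Type*} [CommRing R] (V : WeierstrassCurve R)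
    (h₁ : V.a₁ = 0) (h₃ : V.a₃ = 0) :
    ∃ m : R, V.Δ = 16 * m :=
  ⟨V.a₂ ^ 2 * V.a₄ ^ 2 - 4 * V.a₂ ^ 3 * V.a₆ + 18 * V.a₂ * V.a₄ * V.a₆ - 4 * V.a₄ ^ 3 - 27 * V.a₆ ^ 2, by
    simp only [Δ, b₂, b₄, b₆, b₈, h₁, h₃]; ring⟩

variable {W} in
/-- **For a `ℤ`-integral equation with `a₁ = a₃ = 0` the discriminant is `16` times an INTEGER.**
[Silverman AEC III.1] [cite: SilvermanAEC2009, III.1] -/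
theorem exists_Δ_eq_sixteen_mul_intCast [W.IsIntegral ℤ] (h₁ : W.a₁ = 0) (h₃ : W.a₃ = 0) :
    ∃ m : ℤ, W.Δ = 16 * (m : ℚ) := by
  obtain ⟨V, hV⟩ := (IsIntegral.integral : ∃ V : WeierstrassCurve ℤ, W = V.baseChange ℚ)
  have hV₁ : V.a₁ = 0 := by
    have h := congrArg WeierstrassCurve.a₁ hV
    rw [h₁] at h; simp [baseChange] at h; exact_mod_cast h.symm
  have hV₃ : V.a₃ = 0 := by
    have h := congrArg WeierstrassCurve.a₃ hV
    rw [h₃] at h; simp [baseChange] at h; exact_mod_cast h.symm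
  obtain ⟨m, hm⟩ := V.exists_Δ_eq_sixteen_mul_of_a₁_a₃ hV₁ hV₃
  refine ⟨m, ?_⟩
  rw [hV, baseChange, map_Δ, hm]
  push_cast
  rfl

variable {W} in
/-- **`(a₁, a₃) ≠ (0, 0)` whenever `Δ` is an integer not divisible by `16`** (e.g. `4 ∤ Δ`, i.e. a
square-free-sieved member at the prime `2`, or any `(±1, r, s, t)`-model of it: `Δ` is unchanged).
[Silverman AEC III.1] [cite: SilvermanAEC2009, III.1] -/
theorem a₁_ne_zero_or_a₃_ne_zero_of_not_sixteen_dvd [W.IsIntegral ℤ] {z : ℤ} (hz : W.Δ = z)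
    (h16 : ¬ (16 : ℤ) ∣ z) : W.a₁ ≠ 0 ∨ W.a₃ ≠ 0 := by
  by_contra h
  push Not at h
  obtain ⟨m, hm⟩ := exists_Δ_eq_sixteen_mul_intCast h.1 h.2
  refine h16 ⟨m, ?_⟩
  have : (z : ℚ) = ((16 * m : ℤ) : ℚ) := by push_cast; rw [← hz, hm]
  exact_mod_cast this

variable {W p} in
/-- **A canonical datum on a curve of positive rank forces the Mazur–Tate pair** (`ℤ`-integral
elliptic `W/ℚ`, `p` odd, `(a₁, a₃) ≠ (0, 0)`, a point of infinite order): combine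
`exists_isAdmissible_a₁_mul_add_a₃_ne_zero` with `IsCanonical.exists_isMazurTateSigmaPair`.
[cite: MazurSteinTate2006, Thm. 1.3 and §1 eq. (1.1)] [cite: SteinWuthrich2013, §4.1 eq. (4.1)] -/
theorem PAdicHeightData.IsCanonical.exists_isMazurTateSigmaPair_of_not_isOfFinAddOrder
    [W.IsElliptic] [W.IsIntegral ℤ] (hp : p ≠ 2) {Dh : PAdicHeightData W p} (hDh : Dh.IsCanonical)
    {P : W.toAffine.Point} (hP : ¬ IsOfFinAddOrder P) (ha : W.a₁ ≠ 0 ∨ W.a₃ ≠ 0) :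
    ∃ σ : ℚ_[p]⟦X⟧, ∃ c : ℚ_[p], (W.baseChange ℚ_[p]).IsMazurTateSigmaPair σ c := by
  obtain ⟨x, y, hxy, hQ, hax⟩ := W.exists_isAdmissible_a₁_mul_add_a₃_ne_zero (p := p) hP ha
  exact hDh.exists_isMazurTateSigmaPair hp hQ hax

variable {W p} in
/-- Same, concluding that `σ_p = padicSigma (W ⊗ ℚ_p)` IS a Mazur–Tate pair.
[cite: MazurSteinTate2006, Thm. 1.3] -/
theorem PAdicHeightData.IsCanonical.isMazurTateSigmaPair_padicSigma_of_not_isOfFinAddOrder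
    [W.IsElliptic] [W.IsIntegral ℤ] (hp : p ≠ 2) {Dh : PAdicHeightData W p} (hDh : Dh.IsCanonical)
    {P : W.toAffine.Point} (hP : ¬ IsOfFinAddOrder P) (ha : W.a₁ ≠ 0 ∨ W.a₃ ≠ 0) :
    (W.baseChange ℚ_[p]).IsMazurTateSigmaPair (W.baseChange ℚ_[p]).padicSigma
      (W.baseChange ℚ_[p]).padicSigmaConst :=
  (W.baseChange ℚ_[p]).isMazurTateSigmaPair_padicSigma
    (hDh.exists_isMazurTateSigmaPair_of_not_isOfFinAddOrder hp hP ha)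

/-- A Weierstrass curve over `ℚ` with `rank E(ℚ) ≠ 0` has a point of infinite order
(`mordellWeilRank = finrank_ℤ E(ℚ)`; a finite-rank-zero criterion `rank_eq_zero_iff`).
[Silverman AEC VIII.6 (Mordell–Weil: `E(ℚ) ≅ E(ℚ)_tors × ℤ^r`)] [cite: SilvermanAEC2009, VIII.6.7] -/
theorem exists_not_isOfFinAddOrder_of_mordellWeilRank_ne_zero (hr : W.mordellWeilRank ≠ 0) :
    ∃ P : W.toAffine.Point, ¬ IsOfFinAddOrder P := by
  have hr' : 0 < Module.finrank ℤ W.toAffine.Point := by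
    have h : 0 < W.mordellWeilRank := Nat.pos_of_ne_zero hr
    unfold mordellWeilRank at h
    convert h
  have hrank : Module.rank ℤ W.toAffine.Point ≠ 0 := by
    have hlt : ((0 : ℕ) : Cardinal) < Module.rank ℤ W.toAffine.Point :=
      Module.lt_rank_of_lt_finrank hr'
    exact ne_of_gt (by simpa using hlt)
  have hP : ¬ ∀ x : W.toAffine.Point, ∃ a : ℤ, a ≠ 0 ∧ a • x = 0 :=
    fun hall => hrank (rank_eq_zero_iff.2 hall)
  push Not at hP
  obtain ⟨P, hP⟩ := hP
  refine ⟨P, fun hfin => ?_⟩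
  obtain ⟨n, hn, hnP⟩ := (isOfFinAddOrder_iff_nsmul_eq_zero).1 hfin
  exact hP (n : ℤ) (by exact_mod_cast hn.ne') (by rwa [natCast_zsmul])

variable {W p} in
/-- **Rank form.** For a `ℤ`-integral elliptic `W/ℚ` of positive Mordell–Weil rank with
`(a₁, a₃) ≠ (0, 0)` and an odd prime `p`, every canonical `p`-adic height datum lives in the genuine
branch: `σ_p` is a Mazur–Tate pair. This is the form used by the cell's crux `SchneiderOnDoorSubfamily`
at `p = 3` (rank `2`, `4 ∤ Δ` on the sieved family, any globally minimal model).
[cite: MazurSteinTate2006, Thm. 1.3] [cite: SteinWuthrich2013, §4.1 eq. (4.1)] -/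
theorem PAdicHeightData.IsCanonical.isMazurTateSigmaPair_padicSigma_of_mordellWeilRank_ne_zero
    [W.IsElliptic] [W.IsIntegral ℤ] (hp : p ≠ 2) {Dh : PAdicHeightData W p} (hDh : Dh.IsCanonical)
    (hr : W.mordellWeilRank ≠ 0) (ha : W.a₁ ≠ 0 ∨ W.a₃ ≠ 0) :
    (W.baseChange ℚ_[p]).IsMazurTateSigmaPair (W.baseChange ℚ_[p]).padicSigma
      (W.baseChange ℚ_[p]).padicSigmaConst := by
  obtain ⟨P, hP⟩ := W.exists_not_isOfFinAddOrder_of_mordellWeilRank_ne_zero hr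
  exact hDh.isMazurTateSigmaPair_padicSigma_of_not_isOfFinAddOrder hp hP ha

variable {W p} in
/-- **Existence form of the rank version**: `∃ σ c, IsMazurTateSigmaPair (W ⊗ ℚ_p) σ c`.
[cite: MazurSteinTate2006, Thm. 1.3] -/
theorem PAdicHeightData.IsCanonical.exists_isMazurTateSigmaPair_of_mordellWeilRank_ne_zero
    [W.IsElliptic] [W.IsIntegral ℤ] (hp : p ≠ 2) {Dh : PAdicHeightData W p} (hDh : Dh.IsCanonical)
    (hr : W.mordellWeilRank ≠ 0) (ha : W.a₁ ≠ 0 ∨ W.a₃ ≠ 0) :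
    ∃ σ : ℚ_[p]⟦X⟧, ∃ c : ℚ_[p], (W.baseChange ℚ_[p]).IsMazurTateSigmaPair σ c := by
  obtain ⟨P, hP⟩ := W.exists_not_isOfFinAddOrder_of_mordellWeilRank_ne_zero hr
  exact hDh.exists_isMazurTateSigmaPair_of_not_isOfFinAddOrder hp hP ha


end Rat

end WeierstrassCurve

end
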